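import Literature.AlgebraicGeometry.HodgeTheory.MumfordTateRankUnitaryPairBlocks
import Literature.AlgebraicGeometry.Motives.HodgeThetaAnnihilatorRankOneCentreTimesQSimpleTorus
import HarnessLib

/-!
# Descent of solution spaces from `ℂ` to `ℚ`, eigen-projectors of an imaginary quadratic operator, and the central part of `Θ`
# (plumbing for the unitary analogue of Moonen–Zarhin's Lemma (3.4), step 2: `CorCM/MumfordTateRankUnitaryPairGraph`)

COR-CM (cell `pub-hodgecm2`, seat `b27` gen 52, count-neutral Mumford–Tate-rank ladder; theorems only, no definition, no named fact; UNCONDITIONAL —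
nothing here uses or asserts HC_CM).
* §1 `spanC_top` (`End_ℚ(V) ⊗ ℂ = End_ℂ(V_ℂ)`), **`mem_spanC_ker_of_map_eq_zero`** (a complex solution of a rational linear equation on operators lies in
  the complex span of the rational solutions: complement of the kernel + «injectivity complexifies», `eq_zero_of_map_eq_zero_of_mem_spanC`),
  `spanC_inf_finset` (complex spans commute with finite intersections).
* §2 `apply_incl₁_of_mem_spanC`, `apply_incl₂_of_mem_spanC` — block form of `𝔥(H) ⊗ ℂ` evaluated on `ι₁x`, `ι₂y`;
  `exists_theta_eq_center_add_derived` — for `Θ ∈ 𝔥(H) ⊗ ℂ`: `Θ = c₁·ι₁φ₁π₁ + c₂·ι₂φ₂π₂ + Θ′` with `Θ′ ∈ [𝔥,𝔥] ⊗ ℂ`, from Deligne's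
  `𝔥 = 𝔷 ⊕ [𝔥,𝔥]` (`AnyWeight.hodgeLie_center_sup_derived_eq`) when the `ψ`-skew centre of `End_Hdg(H)` lies in `ℚι₁φ₁π₁ + ℚι₂φ₂π₂`.
* §3 `projector_facts` — `e = (μ + φ)/2μ` for `φ² = μ²`: `φe = μe`, `φ(1 − e) = −μ(1 − e)`, `e` commutes with the commutant of `φ`;
  `eq_zero_of_shift_sq` — `(A + σ)²y = y = (A − σ)²y` with `σ ≠ 0`, `σ² ≠ 1` forces `y = 0` (the disjoint-spectra step).

## References
* [Deligne1982HodgeCycles] P. Deligne, *Hodge cycles on abelian varieties*, LNM 900 (1982), I §3 (proof of Prop. 3.4; Prop. 3.6).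
  [cite: Deligne1982HodgeCycles, I §3 (proof of Prop. 3.4)]
* [MoonenZarhin1999LowDim] B. Moonen, Yu. G. Zarhin, Math. Ann. 315 (1999), §3 (3.1). [cite: MoonenZarhin1999LowDim, §3 (3.1)]

Provenance: Literature home (namespace `Literature.AlgebraicGeometry.HodgeTheory.MumfordTateRank`) of the Summits-side `CorCM/MumfordTateRankUnitaryPairDescent` (cell `pub-hodgecm2`, COR-CM; all its imports are `Literature/`, Mathlib and the already re-homed `MumfordTateRankUnitaryPairBlocks`), which `Literature/` may not import; theorems only, no named fact, no definition. Nothing here bears on `HC_CM`. Lane `lit-hodgefound` (Layer A3: CM types, their Kubota ranks and Galois combinatorics), seat p20.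
-/

noncomputable section

open scoped TensorProduct

namespace Literature.AlgebraicGeometry.HodgeTheory.MumfordTateRank

namespace UnitaryPair

open Literature.AlgebraicGeometry.Motives Literature.AlgebraicGeometry.Motives.HodgeStructure Module

universe u

/-! ## §1 Descent of solution spaces -/

section Descent

variable {V : Type u} [AddCommGroup V] [Module ℚ V] [Module.Finite ℚ V] {V' : Type u} [AddCommGroup V'] [Module ℚ V'] [Module.Finite ℚ V']

/-- `(End_ℚ V) ⊗ ℂ = End_ℂ(V_ℂ)`: the complex span of all rational operators is everything (equal dimensions `(dim V)²`).
[cite: Deligne1982HodgeCycles, I §3 (proof of Prop. 3.4)] -/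
theorem spanC_top : spanC (⊤ : Submodule ℚ (Module.End ℚ V)) = ⊤ := by
  apply Submodule.eq_top_of_finrank_eq
  rw [finrank_spanC_eq, finrank_top, Module.finrank_linearMap, Module.finrank_linearMap, Module.finrank_baseChange]

/-- **Descent.**  If `LC` is the complexification of a rational linear map `L` on operators and `LC T = 0`, then `T` lies in the complex span of
`ker L`: `T = T_k + T_c` along a complement `C` of `ker L`, and `LC` is injective on `C ⊗ ℂ` (`eq_zero_of_map_eq_zero_of_mem_spanC`).
[cite: Deligne1982HodgeCycles, I §3 (proof of Prop. 3.4)] -/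
theorem mem_spanC_ker_of_map_eq_zero (L : Module.End ℚ V →ₗ[ℚ] Module.End ℚ V')
    (LC : Module.End ℂ (ℂ ⊗[ℚ] V) →ₗ[ℂ] Module.End ℂ (ℂ ⊗[ℚ] V')) (hLC : ∀ X : Module.End ℚ V, LC (X.baseChange ℂ) = (L X).baseChange ℂ)
    {T : Module.End ℂ (ℂ ⊗[ℚ] V)} (hT : LC T = 0) : T ∈ spanC (LinearMap.ker L) := by
  obtain ⟨C, hC⟩ := (LinearMap.ker L).exists_isCompl
  have hTtop : T ∈ spanC (⊤ : Submodule ℚ (Module.End ℚ V)) := by rw [spanC_top]; exact Submodule.mem_top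
  rw [← hC.sup_eq_top, spanC_sup] at hTtop
  obtain ⟨Tk, hTk, Tc, hTc, rfl⟩ := Submodule.mem_sup.1 hTtop
  have hk : LC Tk = 0 := by
    have h := map_mem_spanC_map L LC hLC (LinearMap.ker L) hTk
    have hbot : (LinearMap.ker L).map L = ⊥ := (Submodule.eq_bot_iff _).2 (by rintro _ ⟨y, hy, rfl⟩; exact hy)
    rw [hbot] at h
    have h' : LC Tk ∈ (⊥ : Submodule ℂ (Module.End ℂ (ℂ ⊗[ℚ] V'))) := by
      refine (Submodule.span_le.2 ?_) h
      rintro _ ⟨y, hy, rfl⟩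
      rw [SetLike.mem_coe, show y = 0 from hy]
      change (0 : Module.End ℚ V').baseChange ℂ ∈ _
      rw [LinearMap.baseChange_zero]
      exact Submodule.zero_mem _
    exact (Submodule.mem_bot ℂ).1 h'
  have hc : Tc = 0 := eq_zero_of_map_eq_zero_of_mem_spanC L LC hLC C
    (fun X hX hX0 => by
      have h : X ∈ LinearMap.ker L ⊓ C := ⟨hX0, hX⟩
      rw [hC.inf_eq_bot] at h
      exact (Submodule.mem_bot ℚ).1 h) hTc (by rw [map_add, hk, zero_add] at hT; exact hT)
  rw [hc, add_zero]
  exact hTk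

/-- Complex spans commute with finite intersections (`spanC_inf`, `spanC_top`). [cite: Deligne1982HodgeCycles, I §3 (proof of Prop. 3.4)] -/
theorem spanC_inf_finset {ι : Type*} [DecidableEq ι] (s : Finset ι) (𝔞 : ι → Submodule ℚ (Module.End ℚ V)) :
    spanC (s.inf 𝔞) = s.inf fun j => spanC (𝔞 j) := by
  induction s using Finset.induction_on with
  | empty => rw [Finset.inf_empty, Finset.inf_empty]; exact spanC_top
  | insert a s ha ih => rw [Finset.inf_insert, Finset.inf_insert, spanC_inf, ih]

end Descent

/-! ## §2 Blocks evaluated, and the central part of a Hodge operator -/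

section Blocks

variable {V₁ : Type u} [AddCommGroup V₁] [Module ℚ V₁]
  {V₂ : Type u} [AddCommGroup V₂] [Module ℚ V₂]
  {V : Type u} [AddCommGroup V] [Module ℚ V] [Module.Finite ℚ V] [HodgeTensorFacts.{u, u}] {n : ℤ}
  {H₁ : HodgeStructure V₁ n} {H₂ : HodgeStructure V₂ n} {H : HodgeStructure V n}
  (ι₁ : Hom H₁ H) (π₁ : Hom H H₁) (ι₂ : Hom H₂ H) (π₂ : Hom H H₂)
  (hπι₁ : ∀ v, π₁.toLinearMap (ι₁.toLinearMap v) = v) (hπι₂ : ∀ v, π₂.toLinearMap (ι₂.toLinearMap v) = v)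
  (hsum : ∀ v, ι₁.toLinearMap (π₁.toLinearMap v) + ι₂.toLinearMap (π₂.toLinearMap v) = v)

include hπι₁ hπι₂ hsum in
/-- `B(ι₁x) = ι₁(π₁Bι₁ x)` for `B ∈ 𝔥(H) ⊗ ℂ` (block form). [cite: MoonenZarhin1999LowDim, §3 (3.1)] -/
theorem apply_incl₁_of_mem_spanC {B : Module.End ℂ (ℂ ⊗[ℚ] V)} (hB : B ∈ spanC H.hodgeLie) (x : ℂ ⊗[ℚ] V₁) :
    B (ι₁.toLinearMap.baseChange ℂ x) =
      ι₁.toLinearMap.baseChange ℂ (π₁.toLinearMap.baseChange ℂ (B (ι₁.toLinearMap.baseChange ℂ x))) := by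
  have h := congrArg (fun f => f (ι₁.toLinearMap.baseChange ℂ x)) (eq_sum_blocks_of_mem_spanC ι₁ π₁ ι₂ π₂ hπι₁ hπι₂ hsum hB)
  simp only [LinearMap.add_apply, LinearMap.comp_apply, proj_incl_baseChange (LinearMap.ext hπι₁ : π₁.toLinearMap ∘ₗ ι₁.toLinearMap = _),
    proj_incl_baseChange_eq_zero (proj₂_comp_incl₁ ι₁ π₁ ι₂ π₂ hπι₁ hπι₂ hsum), map_zero, add_zero] at h
  exact h

include hπι₁ hπι₂ hsum in
/-- `B(ι₂y) = ι₂(π₂Bι₂ y)` for `B ∈ 𝔥(H) ⊗ ℂ`. [cite: MoonenZarhin1999LowDim, §3 (3.1)] -/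
theorem apply_incl₂_of_mem_spanC {B : Module.End ℂ (ℂ ⊗[ℚ] V)} (hB : B ∈ spanC H.hodgeLie) (y : ℂ ⊗[ℚ] V₂) :
    B (ι₂.toLinearMap.baseChange ℂ y) =
      ι₂.toLinearMap.baseChange ℂ (π₂.toLinearMap.baseChange ℂ (B (ι₂.toLinearMap.baseChange ℂ y))) := by
  have h := congrArg (fun f => f (ι₂.toLinearMap.baseChange ℂ y)) (eq_sum_blocks_of_mem_spanC ι₁ π₁ ι₂ π₂ hπι₁ hπι₂ hsum hB)
  simp only [LinearMap.add_apply, LinearMap.comp_apply, proj_incl_baseChange (LinearMap.ext hπι₂ : π₂.toLinearMap ∘ₗ ι₂.toLinearMap = _),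
    proj_incl_baseChange_eq_zero (proj₁_comp_incl₂ ι₁ π₁ ι₂ π₂ hπι₁ hπι₂ hsum), map_zero, zero_add] at h
  exact h

/-- **The central part of `Θ`.**  If the `ψ`-skew centre `𝔥(H) ∩ End_Hdg(H)` lies in `ℚι₁φ₁π₁ + ℚι₂φ₂π₂`, then every `Θ ∈ 𝔥(H) ⊗ ℂ` is
`c₁·ι₁φ₁π₁ + c₂·ι₂φ₂π₂ + Θ′` with `Θ′ ∈ [𝔥(H),𝔥(H)] ⊗ ℂ` (Deligne: `𝔥 = 𝔷 ⊕ [𝔥,𝔥]`). [cite: Deligne1982HodgeCycles, I §3 (proof of Prop. 3.4)] -/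
theorem exists_theta_eq_center_add_derived (ψ : H.Polarization) {φ₁ : Module.End ℚ V₁} {φ₂ : Module.End ℚ V₂}
    (hZ : ∀ z ∈ H.hodgeLie ⊓ Subalgebra.toSubmodule H.endAlg, ∃ x₁ x₂ : ℚ,
      z = x₁ • (ι₁.toLinearMap ∘ₗ φ₁ ∘ₗ π₁.toLinearMap) + x₂ • (ι₂.toLinearMap ∘ₗ φ₂ ∘ₗ π₂.toLinearMap))
    {Θ : Module.End ℂ (ℂ ⊗[ℚ] V)} (hΘ𝔤 : Θ ∈ spanC H.hodgeLie) :
    ∃ (c₁ c₂ : ℂ) (Θ' : Module.End ℂ (ℂ ⊗[ℚ] V)),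
      Θ' ∈ spanC (Submodule.span ℚ {B | ∃ X ∈ H.hodgeLie, ∃ Y ∈ H.hodgeLie, X * Y - Y * X = B}) ∧
      Θ = c₁ • (ι₁.toLinearMap.baseChange ℂ ∘ₗ φ₁.baseChange ℂ ∘ₗ π₁.toLinearMap.baseChange ℂ) +
        c₂ • (ι₂.toLinearMap.baseChange ℂ ∘ₗ φ₂.baseChange ℂ ∘ₗ π₂.toLinearMap.baseChange ℂ) + Θ' := by
  have hq : ∀ (q : ℚ) (C : Module.End ℚ V), (q • C).baseChange ℂ = (q : ℂ) • C.baseChange ℂ := fun q C =>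
    TensorProduct.AlgebraTensorModule.ext fun z v => by rw [LinearMap.baseChange_tmul, LinearMap.smul_apply, LinearMap.smul_apply,
      LinearMap.baseChange_tmul, TensorProduct.smul_tmul', ← TensorProduct.smul_tmul, Rat.smul_def, smul_eq_mul]
  rw [← AnyWeight.hodgeLie_center_sup_derived_eq H ψ, spanC_sup] at hΘ𝔤
  obtain ⟨ζ, hζ, Θ', hΘ', hζΘ⟩ := Submodule.mem_sup.1 hΘ𝔤
  have hζ' : ζ ∈ (ℂ ∙ (ι₁.toLinearMap.baseChange ℂ ∘ₗ φ₁.baseChange ℂ ∘ₗ π₁.toLinearMap.baseChange ℂ)) ⊔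
      (ℂ ∙ (ι₂.toLinearMap.baseChange ℂ ∘ₗ φ₂.baseChange ℂ ∘ₗ π₂.toLinearMap.baseChange ℂ)) := by
    refine (Submodule.span_le.2 ?_) hζ
    rintro _ ⟨z, hz, rfl⟩
    obtain ⟨x₁, x₂, rfl⟩ := hZ z hz
    rw [SetLike.mem_coe]
    dsimp only
    rw [LinearMap.baseChange_add, hq, hq, LinearMap.baseChange_comp, LinearMap.baseChange_comp, LinearMap.baseChange_comp,
      LinearMap.baseChange_comp]
    exact Submodule.add_mem _ (Submodule.mem_sup_left (Submodule.mem_span_singleton.2 ⟨(x₁ : ℂ), rfl⟩))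
      (Submodule.mem_sup_right (Submodule.mem_span_singleton.2 ⟨(x₂ : ℂ), rfl⟩))
  obtain ⟨a, ha, a', ha', rfl⟩ := Submodule.mem_sup.1 hζ'
  obtain ⟨c₁, rfl⟩ := Submodule.mem_span_singleton.1 ha
  obtain ⟨c₂, rfl⟩ := Submodule.mem_span_singleton.1 ha'
  exact ⟨c₁, c₂, Θ', hΘ', hζΘ.symm⟩

end Blocks

/-! ## §3 Eigen-projectors and the disjoint-spectra step -/

section Algebra

variable {M : Type*} [AddCommGroup M] [Module ℂ M]

/-- **The projector `e = (μ + φ)/2μ` onto `ker(φ − μ)` along `ker(φ + μ)`** for `φ² = μ²`, `μ ≠ 0`: `φ e = μ e`, `φ(1 − e) = −μ(1 − e)`, and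
`e` commutes with every operator commuting with `φ`. [cite: Deligne1982HodgeCycles, §4 (p. 30)] -/
theorem projector_facts (φ : Module.End ℂ M) {μ : ℂ} (hμ : μ ≠ 0) (hφφ : ∀ x, φ (φ x) = (μ * μ) • x) :
    (∀ x, φ (((2 * μ)⁻¹ • (μ • 1 + φ)) x) = μ • ((2 * μ)⁻¹ • (μ • 1 + φ)) x) ∧
    (∀ x, φ (x - ((2 * μ)⁻¹ • (μ • 1 + φ)) x) = (-μ) • (x - ((2 * μ)⁻¹ • (μ • 1 + φ)) x)) ∧
    (∀ T : Module.End ℂ M, T * φ = φ * T → ∀ x, ((2 * μ)⁻¹ • (μ • 1 + φ)) (T x) = T (((2 * μ)⁻¹ • (μ • 1 + φ)) x)) := by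
  have h1 : ∀ x, φ (((2 * μ)⁻¹ • (μ • 1 + φ)) x) = μ • ((2 * μ)⁻¹ • (μ • 1 + φ)) x := fun x => by
    simp only [LinearMap.smul_apply, LinearMap.add_apply, Module.End.one_apply, map_smul, map_add, hφφ]; module
  refine ⟨h1, fun x => ?_, fun T hT x => ?_⟩
  · have h2e : (2 * μ) • ((2 * μ)⁻¹ • (μ • 1 + φ)) x = μ • x + φ x := by
      rw [LinearMap.smul_apply, smul_smul, mul_inv_cancel₀ (mul_ne_zero two_ne_zero hμ), one_smul, LinearMap.add_apply, LinearMap.smul_apply,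
        Module.End.one_apply]
    have hx' : φ x = (2 * μ) • ((2 * μ)⁻¹ • (μ • 1 + φ)) x - μ • x := by rw [h2e]; abel
    rw [map_sub, h1, hx']; module
  · have h := congrArg (fun f => f x) hT
    simp only [Module.End.mul_apply] at h
    simp only [LinearMap.smul_apply, LinearMap.add_apply, Module.End.one_apply, map_smul, map_add, h]

/-- **Disjoint spectra.**  `(A + σ)²y = y = (A − σ)²y` with `σ ≠ 0`, `σ² ≠ 1` forces `y = 0` (subtract: `4σ·Ay = 0`, then `(σ² − 1)y = 0`).
[cite: MoonenZarhin1999LowDim, §3 (3.1)] -/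
theorem eq_zero_of_shift_sq (A : Module.End ℂ M) {σ : ℂ} {y : M} (hσ : σ ≠ 0) (hσ1 : σ ^ 2 ≠ 1)
    (R1 : A (A y + σ • y) + σ • (A y + σ • y) = y) (R2 : A (A y - σ • y) - σ • (A y - σ • y) = y) : y = 0 := by
  rw [map_add, map_smul] at R1
  rw [map_sub, map_smul] at R2
  have h4 : (4 * σ) • A y = 0 := by linear_combination (norm := module) R1 - R2
  have hz : A y = 0 := (smul_eq_zero.1 h4).resolve_left (mul_ne_zero (by norm_num) hσ)
  simp only [hz, map_zero, smul_zero, zero_add, smul_smul] at R1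
  have h5 : (σ ^ 2 - 1) • y = 0 := by rw [sub_smul, sq, R1, one_smul, sub_self]
  exact (smul_eq_zero.1 h5).resolve_left (sub_ne_zero.2 hσ1)

end Algebra

end UnitaryPair

end Literature.AlgebraicGeometry.HodgeTheory.MumfordTateRank

end
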